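import Literature.Probability.RandomPlanarGeometry.SLEKappaRhoAsymmetry
import Literature.Probability.RandomPlanarGeometry.SLEKappaRhoRestriction
import Literature.Probability.RandomPlanarGeometry.SLE
import HarnessLib

/-!
# The driving function of SLE(κ, ρ): `W_t = √κ B_t + ρ ∫₀ᵗ du/Z_u` ([LSW] §8.3), and SLE(κ, 0) = SLE_κ

Level 6 of the decomposition of the named fact
`Literature.Probability.RandomPlanarGeometry.IsRestrictionMeasure.eq_five_eighths_of_simple`
(plan in `RestrictionMeasuresFiveEighths`, …, `SLEKappaRho`, `SLEKappaRhoAsymmetry`), after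

* G. F. Lawler, O. Schramm, W. Werner, *Conformal restriction: the chordal case*, J. Amer. Math.
  Soc. **16** (2003) 917–955, arXiv:math/0209343 (**[LSW]**), §8.3 (the definition of
  SLE(κ, ρ)) and the proof of Cor. 8.6 (p. 38);
* D. Revuz, M. Yor, *Continuous Martingales and Brownian Motion*, 3rd ed. (1999), Ch. XI §1,
  Exercise (1.26) 1°).

The symmetry sentence of [LSW] p. 38 ("the corresponding quantity for SLE(8/3, 0), which is
`1/2` by symmetry"; the named fact `SLEKappaRho.measure_I_notMem_fill_eq_half` of
`SLEKappaRhoAsymmetry`, stated for SLE(8/3, 0) driving PAIRS `(O, W)` of [LSW] §8.3) is about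
ordinary chordal SLE_{8/3}: [LSW] §8.3, "Note also that `∫₀ᵗ du/Z_u = (Z_t − √κ B_t)/(ρ + 2) < ∞`
for all `t ≥ 0`. […] Note that when `ρ = 0`, we get the ordinary chordal SLE_κ." This file
separates the two ingredients:

* the displayed identity `∫₀ᵗ du/Z_u = (Z_t − √κ B_t)/(ρ + 2) < ∞` (a.s., for all `t`) is the
  tree's named fact `SLEKappaRho.integral_inv_eq` (`SLEKappaRhoRestriction`; it is the
  semimartingale decomposition `X_t = B_t + ((d − 1)/2) ∫₀ᵗ du/X_u` of the `d`-dimensional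
  Bessel process `X = Z/√κ` started at `0`, `d = 1 + 2(ρ + 2)/κ > 1`, Revuz–Yor XI,
  Exercise (1.26) 1°));
* PROVED from it: **`W_t = √κ B_t + ρ ∫₀ᵗ du/Z_u`** a.s. (`SLEKappaRho.ae_snd_eq_of`; this is
  the form in which p. 38 uses the definition: "when `ρ < 0`, `W_t − √κ B_t` is decreasing"),
  and **SLE(κ, 0) = SLE_κ**: for `ρ = 0`, a.s. `W = √κ B = sleDriving κ`
  (`SLEKappaRho.ae_snd_eq_sleDriving_of`);
* `Literature.Probability.RandomPlanarGeometry.measure_I_notMem_leftFilling_sle_eq_half` —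
  NAMED FACT, the symmetry sentence for the SLE_{8/3} driving function `√κ B` itself:
  `P{i ∉ F^{ℝ₊}_ℍ(cl K_∞(√(8/3) B))} = 1/2`;
* PROVED: given the Bessel identity, the two forms of the symmetry sentence are equivalent
  (`SLEKappaRho.measure_I_notMem_fill_eq_half_of`, `measure_I_notMem_leftFilling_sle_eq_half_of`).

So the leaf "which is `1/2` by symmetry" of `SLEKappaRhoAsymmetry` is reduced to a statement about
chordal SLE_{8/3} alone (reflection invariance of its law, `Loewner.hull_imagAxisRefl` and
`identDistrib_sleDriving_neg`, plus "a.s. `i` lies on exactly one side of the trace", i.e. the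
SLE_{8/3} trace is a simple curve from `0` to `∞` missing `i` — Rohde–Schramm 2005) and a
statement about Bessel processes alone.
-/

noncomputable section

open Set Filter MeasureTheory
open scoped NNReal ENNReal
open Literature.Probability.Process (preWienerMeasure brownian)

namespace Literature.Probability.RandomPlanarGeometry

/-! ### [LSW] §8.3: `W_t = √κ B_t + ρ ∫₀ᵗ du/Z_u`, and SLE(κ, 0) = SLE_κ -/

/-- `Z = W − O = √κ X` pointwise, so that `O_t = −2 ∫₀ᵗ du/Z_u` literally.
[cite: LawlerSchrammWerner2003Restriction, §8.3 (definition of SLE(κ, ρ))] -/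
theorem IsSLEKappaRhoPair.fst_eq_integral {κ : ℝ≥0} {ρ : ℝ} {O W : ℝ≥0 → (ℝ≥0 → ℝ) → ℝ}
    (h : IsSLEKappaRhoPair κ ρ O W) (t : ℝ≥0) (ω : ℝ≥0 → ℝ) :
    O t ω = -2 * ∫ u in (0 : ℝ)..(t : ℝ), (W u.toNNReal ω - O u.toNNReal ω)⁻¹ := by
  obtain ⟨X, -, hO, hW⟩ := h
  rw [hO t ω]
  congr 1
  refine intervalIntegral.integral_congr fun u _ ↦ ?_
  simp only [hW u.toNNReal ω, add_sub_cancel_right]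

/-- **`W_t = √κ B_t + ρ ∫₀ᵗ du/Z_u`** almost surely, for all `t` ([LSW] §8.3 with p. 38: "when
`ρ < 0`, `W_t − √κ B_t` is decreasing"): from `W = Z + O`, `O_t = −2 ∫₀ᵗ du/Z_u` and the Bessel
identity `∫₀ᵗ du/Z_u = (Z_t − √κ B_t)/(ρ + 2)` (`h`).
[cite: LawlerSchrammWerner2003Restriction, §8.3 (definition of SLE(κ, ρ)) with proof of Cor. 8.6 (p. 38)] -/
theorem SLEKappaRho.ae_snd_eq_of (h : SLEKappaRho.integral_inv_eq) {κ : ℝ≥0} {ρ : ℝ}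
    {O W : ℝ≥0 → (ℝ≥0 → ℝ) → ℝ} (hκ : 0 < κ) (hρ : -2 < ρ) (hOW : IsSLEKappaRhoPair κ ρ O W) :
    ∀ᵐ ω ∂preWienerMeasure, ∀ t : ℝ≥0,
      W t ω = Real.sqrt κ * brownian t ω +
        ρ * ∫ u in (0 : ℝ)..(t : ℝ), (W u.toNNReal ω - O u.toNNReal ω)⁻¹ := by
  filter_upwards [h hκ hρ hOW] with ω hω t
  have hI := (hω t).2
  have hO := hOW.fst_eq_integral t ω
  have hρ2 : ρ + 2 ≠ 0 := by linarith
  rw [hI] at hO ⊢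
  field_simp at hO
  field_simp
  linarith

/-- **SLE(κ, 0) = SLE_κ** ([LSW] §8.3: "Note that when `ρ = 0`, we get the ordinary chordal
SLE_κ"): for an SLE(κ, 0) driving pair, almost surely `W_t = √κ B_t` for all `t`, i.e. the
driving function `t ↦ W_t(ω)` IS the SLE_κ driving function `sleDriving κ ω`.
[cite: LawlerSchrammWerner2003Restriction, §8.3 (definition of SLE(κ, ρ), "when ρ = 0, we get the ordinary chordal SLE_κ")] -/
theorem SLEKappaRho.ae_snd_eq_sleDriving_of (h : SLEKappaRho.integral_inv_eq) {κ : ℝ≥0}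
    {O W : ℝ≥0 → (ℝ≥0 → ℝ) → ℝ} (hκ : 0 < κ) (hOW : IsSLEKappaRhoPair κ 0 O W) :
    ∀ᵐ ω ∂preWienerMeasure, (fun t ↦ W t ω) = sleDriving κ ω := by
  filter_upwards [SLEKappaRho.ae_snd_eq_of h hκ (by norm_num) hOW] with ω hω
  funext t
  rw [hω t, sleDriving_apply, zero_mul, add_zero]

/-! ### The symmetry sentence for the SLE_{8/3} driving function, and the equivalence of the two forms -/

/-- NAMED FACT — **"the corresponding quantity for SLE(8/3, 0), which is `1/2` by symmetry"**
([LSW] proof of Cor. 8.6, p. 38), for chordal SLE_{8/3} itself: with `K_t` the Loewner hulls of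
the SLE_{8/3} driving function `√(8/3) B` (`sleDriving (8/3)`), `K_∞ = ⋃ₜ K_t` and
`F^{ℝ₊}_ℍ` the left filling of [LSW] §2, the probability that `i` ends up to the right of the
path, `P{i ∉ F^{ℝ₊}_ℍ(cl K_∞)}`, is `1/2`. Printed ingredients of "by symmetry": the law of
`√κ B` is invariant under `B ↦ −B` (`identDistrib_sleDriving_neg`) and the hulls of `−W` are
the mirror images `x + iy ↦ −x + iy` of those of `W` (`Loewner.hull_imagAxisRefl`), which
exchanges "`i` right of `K_∞`" and "`i` left of `K_∞`"; and almost surely exactly one of the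
two holds, because the SLE_{8/3} trace is a simple curve from `0` to `∞` not passing through `i`
(Rohde–Schramm 2005, Thms. 5.1, 6.1, 7.1: the tree's named facts behind `HasSLETrace`,
`ae_isSimpleTrace_sleTrace_of_le_four`, `tendsto_norm_sleTrace_atTop`; and the Jordan curve
theorem, `Literature.Topology.PlaneTopology.JordanCurveTheorem_holds`).
[cite: LawlerSchrammWerner2003Restriction, proof of Cor. 8.6 (p. 38), second sentence ("which is 1/2 by symmetry")] -/
def measure_I_notMem_leftFilling_sle_eq_half : Prop :=
  preWienerMeasure {ω | Complex.I ∉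
      leftFilling (closure (Loewner.hullUnion (sleDriving ((8 : ℝ≥0) / 3) ω)))} = 1 / 2

/-- For an SLE(8/3, 0) pair, the event `{i ∉ F^{ℝ₊}_ℍ(cl K_∞(W))}` is a.e. the same event for
the SLE_{8/3} driving function (given the Bessel identity). [cite: LawlerSchrammWerner2003Restriction, §8.3 (SLE(κ, 0) = SLE_κ)] -/
theorem SLEKappaRho.setOf_I_notMem_fill_ae_eq_of (h : SLEKappaRho.integral_inv_eq)
    {O W : ℝ≥0 → (ℝ≥0 → ℝ) → ℝ} (hOW : IsSLEKappaRhoPair (8 / 3) 0 O W) :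
    {ω | Complex.I ∉ sleKappaRhoFill W ω} =ᵐ[preWienerMeasure]
      {ω | Complex.I ∉ leftFilling (closure (Loewner.hullUnion (sleDriving ((8 : ℝ≥0) / 3) ω)))} := by
  filter_upwards [SLEKappaRho.ae_snd_eq_sleDriving_of h (by positivity) hOW] with ω hω
  show (Complex.I ∉ sleKappaRhoFill W ω) =
    (Complex.I ∉ leftFilling (closure (Loewner.hullUnion (sleDriving ((8 : ℝ≥0) / 3) ω))))
  rw [sleKappaRhoFill, hω]

/-- **The symmetry sentence for SLE(8/3, 0) pairs from the one for SLE_{8/3}** (and the Bessel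
identity): `SLEKappaRho.measure_I_notMem_fill_eq_half` of `SLEKappaRhoAsymmetry`.
[cite: LawlerSchrammWerner2003Restriction, proof of Cor. 8.6 (p. 38) with §8.3 (SLE(κ, 0) = SLE_κ)] -/
theorem SLEKappaRho.measure_I_notMem_fill_eq_half_of (h : SLEKappaRho.integral_inv_eq)
    (h₀ : measure_I_notMem_leftFilling_sle_eq_half) : SLEKappaRho.measure_I_notMem_fill_eq_half := by
  intro O W hOW
  rw [measure_congr (SLEKappaRho.setOf_I_notMem_fill_ae_eq_of h hOW)]
  exact h₀

/-- Conversely the SLE_{8/3} form follows from the form for pairs (SLE(8/3, 0) pairs exist,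
`exists_isSLEKappaRhoPair`), so that the two are equivalent given the Bessel identity.
[cite: LawlerSchrammWerner2003Restriction, proof of Cor. 8.6 (p. 38) with §8.3 (SLE(κ, 0) = SLE_κ)] -/
theorem measure_I_notMem_leftFilling_sle_eq_half_of (h : SLEKappaRho.integral_inv_eq)
    (h₁ : SLEKappaRho.measure_I_notMem_fill_eq_half) : measure_I_notMem_leftFilling_sle_eq_half := by
  obtain ⟨O, W, hOW⟩ := exists_isSLEKappaRhoPair (8 / 3) 0
  unfold measure_I_notMem_leftFilling_sle_eq_half
  rw [← measure_congr (SLEKappaRho.setOf_I_notMem_fill_ae_eq_of h hOW)]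
  exact h₁ hOW

/-- **The target fact from the three printed leaves**: the Bessel identity of §8.3, the
symmetry sentence for SLE_{8/3} and the comparison sentence of p. 38 give
`SLEKappaRho.one_half_lt_measure_I_notMem_fill`.
[cite: LawlerSchrammWerner2003Restriction, proof of Cor. 8.6 (p. 38), first two sentences, with §8.3] -/
theorem SLEKappaRho.one_half_lt_measure_I_notMem_fill_of_leaves (h : SLEKappaRho.integral_inv_eq)
    (h₀ : measure_I_notMem_leftFilling_sle_eq_half)
    (h₂ : SLEKappaRho.measure_I_notMem_fill_lt_of_neg) :
    SLEKappaRho.one_half_lt_measure_I_notMem_fill :=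
  SLEKappaRho.one_half_lt_measure_I_notMem_fill_of (SLEKappaRho.measure_I_notMem_fill_eq_half_of h h₀) h₂

/-- Likewise the non-strict half from Thm. 8.4 (`SLEKappaRho.one_half_le_measure_I_notMem_fill_of`)
with the symmetry sentence in its SLE_{8/3} form.
[cite: LawlerSchrammWerner2003Restriction, proof of Cor. 8.6 (p. 38) with Thm. 8.4 (p. 37) and §8.3] -/
theorem SLEKappaRho.one_half_le_measure_I_notMem_fill_of_leaves
    (h84 : SLEKappaRho.isRightRestrictionMeasure_fill) (h : SLEKappaRho.integral_inv_eq)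
    (h₀ : measure_I_notMem_leftFilling_sle_eq_half)
    {ρ : ℝ} {O W : ℝ≥0 → (ℝ≥0 → ℝ) → ℝ} (hρ : -2 < ρ) (hρ0 : ρ < 0)
    (hOW : IsSLEKappaRhoPair (8 / 3) ρ O W) :
    1 / 2 ≤ preWienerMeasure {ω | Complex.I ∉ sleKappaRhoFill W ω} :=
  SLEKappaRho.one_half_le_measure_I_notMem_fill_of h84
    (SLEKappaRho.measure_I_notMem_fill_eq_half_of h h₀) hρ hρ0 hOW

end Literature.Probability.RandomPlanarGeometry

end
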